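import Literature.AlgebraicGeometry.Resolution.CartierDivisorControlledTransform
import Literature.AlgebraicGeometry.Resolution.BlowupRestrictOpen
import Literature.AlgebraicGeometry.Resolution.RegularSubschemeLocallyIrreducible
import Literature.AlgebraicGeometry.Resolution.StrictTransformBaseChange
import Literature.AlgebraicGeometry.Resolution.KollarTripleMaxOrd
import Literature.AlgebraicGeometry.Resolution.EffectiveCartierStalks
import HarnessLib

/-!
# [OURS · L1 W4.5(b) · EL♮ · RUNG LC «large characteristic», de-risk brick LC-ST] THE CONTROLLED TRANSFORM OF A HYPERSURFACE WITH ANY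
# WEIGHT `m ≥` ITS ORDERS ALONG A REGULAR CENTRE IS ITS STRICT TRANSFORM

res-L1-w45b-stub-4 g17 (STUB WORKER 4; desk ★★ R94 of 2026-08-29 «NAMED WORK for stub-4 g17 = RUNG LC DE-RISK BRICKS: (1) LC-ST»; shape by
res-L1-w45b-idea-2 g32, memo `Cruxes/EquisingularLiftNatThree/LARGE-CHAR-RUNG-idea2.md` v1.1 ada089db502dd96d §2 (B2) / §5 (r1)).  Crux context
EL♮(3) = stmt-ResolutionOfSingularities-20148 (parent EL♮ stmt-…-20038; bookkeeping crux stmt-…-15660).  OURS; NOT a statement of any manuscript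
([Hironaka2017] is a candidate under adjudication, nothing of it is asserted or imported); AI-written, weaker than expert review.  DEF-FREE; no `sorry`;
standard axioms; Literature/Resolution vocabulary only; `--supports stmt-…-20148 --as helper`, counted 0.  EL♮(3) / EL♮ / `EquisingularLift` NOT proved.

WHAT.  Let `τ : W′ → W` be a blowing up of a regular locally Noetherian scheme `W` along the ideal `C` of a REGULAR nowhere-dense closed subscheme
`V(C)` (any number of irreducible components), `E = V(C𝒪_{W′})` its exceptional divisor, and `𝓗` an effective Cartier ideal (a hypersurface).  If
`ord_x 𝓗 ≤ m` at every point `x ∈ V(C)` — in particular if `m ≥ max-ord 𝓗`, the marking of Kollár's order-reduction round in the rung's step (B2) —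
then the controlled (weak) transform with weight `m` IS the scheme-theoretic strict transform:
  `(τ^*𝓗 : 𝓘_E^m) = ⋃ₙ (τ^*𝓗 : 𝓘_Eⁿ)`   (`LargeChar.controlledTransform_eq_strictTransformIdeal_of_idealOrder_le`).
Only «`ord ≤ m` ON THE CENTRE» is used (no `≥`): along each irreducible component `Z` of `V(C)` with generic order `a := ord_{η_Z} 𝓗 ≤ m` one has locally
`τ^*𝓗 = (e^a · f)` with `e` the prime local equation of `E` and `e ∤ f`, so `(τ^*𝓗 : e^m) = (f) = (τ^*𝓗 : e^∞)` for every `m ≥ a`.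
PROOF = the tree's irreducible-centre, exact-weight theorem ✓ `IsBlowup.strictTransformIdeal_eq_controlledTransform` (CartierDivisorControlledTransform,
Kollár 3.30.2 / BGMW Lemma 3.2.1) applied on an open `V ∋ τ x′` of `W` over which `V(C)` is irreducible (✓ `exists_opens_isIrreducible_support_inter`,
regular subschemes are locally irreducible), transported back along the restricted blow-up `τ ∣_ V` (✓ `IsBlowup.morphismRestrict`,
✓ `controlledTransform_morphismRestrict`, ✓ `strictTransformIdeal_morphismRestrict`), and the monotonicity of the controlled transform in the weight.
Also: the stalk-principal phrasing `…_of_forall_isPrincipal` (hypersurface = every stalk principal and nonzero, ✓ `isEffectiveCartier_of_forall_mem_nonZeroDivisors`)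
and the exact-weight corollary `…_of_forall_idealOrder_eq` with a non-irreducible centre (the currency of ✓ `CentreSeq.IsAdmissibleFor`: `supp C ⊆ cosupp(𝓗, m)`
and `max-ord ≤ m`).  [cite: Kollar2007, 3.30.2 and 3.58–3.60] [cite: BierstoneGrigorievMilmanWlodarczyk2011, §3.2, Lemma 3.2.1] (method; index only).
-/

set_option linter.dupNamespace false -- mandated namespace `Summit.<Summit>.<Problem>` of this single-conjunct summit

noncomputable section

open CategoryTheory CategoryTheory.Limits AlgebraicGeometry TopologicalSpace Topology IsLocalRing
open Literature.AlgebraicGeometry.Resolution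
open AlgebraicGeometry.Scheme.IdealSheafData

namespace Summit.ResolutionOfSingularities.ResolutionOfSingularities.Cruxes.EquisingularLiftNat.Sections

namespace LargeChar

universe u

variable {W W' : Scheme.{u}} {τ : W' ⟶ W} {C 𝓗 : W.IdealSheafData} {m : ℕ}

/-! ## The controlled transform is monotone in the weight -/

/-- `(τ^*I : 𝓘_E^a) ⊆ (τ^*I : 𝓘_E^m)` for `a ≤ m` (one divides by a higher power of the exceptional ideal). [folklore] -/
theorem controlledTransform_mono_weight (τ : W' ⟶ W) (C I : W.IdealSheafData) {a m : ℕ} (h : a ≤ m) :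
    controlledTransform τ C I a ≤ controlledTransform τ C I m := by
  refine colon_antitone_right _ ?_
  intro U
  rw [Scheme.IdealSheafData.ideal_pow, Scheme.IdealSheafData.ideal_pow]
  exact Ideal.pow_le_pow_right h

/-! ## Stalks of ideal sheaves along an open immersion -/

/-- Along an open immersion `f`, an inclusion of pulled-back stalks `(I·𝒪_V)_v ⊆ (J·𝒪_V)_v` descends to `I_x ⊆ J_x` at `x = f v` (the stalk
map is an isomorphism). [folklore] -/
theorem stalkIdeal_le_of_stalkIdeal_comap_le {V X : Scheme.{u}} (f : V ⟶ X) [IsOpenImmersion f] {I J : X.IdealSheafData} {x : X} (v : V)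
    (hv : f v = x) (h : stalkIdeal (I.comap f) v ≤ stalkIdeal (J.comap f) v) : stalkIdeal I x ≤ stalkIdeal J x := by
  subst hv
  let e : X.presheaf.stalk (f v) ≃+* V.presheaf.stalk v := (asIso (f.stalkMap v)).commRingCatIsoToRingEquiv
  have hb : Function.Bijective (f.stalkMap v).hom := e.bijective
  rw [stalkIdeal_comap_eq_map_stalkMap, stalkIdeal_comap_eq_map_stalkMap] at h
  rw [← Ideal.comap_map_of_bijective (f.stalkMap v).hom hb (I := stalkIdeal I (f v)),
    ← Ideal.comap_map_of_bijective (f.stalkMap v).hom hb (I := stalkIdeal J (f v))]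
  exact Ideal.comap_mono h

/-! ## LC-ST -/

/-- ★ **LC-ST — the controlled transform of a hypersurface with any weight `m ≥` its orders along the centre is its strict transform.**  `W` regular
locally Noetherian, `V(C)` a regular nowhere-dense closed subscheme, `τ` a blowing up along `C`, `𝓗` an effective Cartier ideal with `ord_x 𝓗 ≤ m` for
every `x ∈ V(C)`: `(τ^*𝓗 : 𝓘_E^m) = ⋃ₙ (τ^*𝓗 : 𝓘_Eⁿ)`.  (Locally on `W` the centre is irreducible with generic order `a ≤ m`, where the tree's exact-weight
theorem gives `⋃ₙ (τ^*𝓗 : 𝓘_Eⁿ) = (τ^*𝓗 : 𝓘_E^a) ⊆ (τ^*𝓗 : 𝓘_E^m)`.) [cite: Kollar2007, 3.30.2] -/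
theorem controlledTransform_eq_strictTransformIdeal_of_idealOrder_le [IsLocallyNoetherian W]
    (hW : Scheme.IsRegular W) (hC : Scheme.IsRegular C.subscheme) (hint : interior (C.support : Set W) = ∅)
    (hτ : IsBlowup τ C) (h𝓗 : IsEffectiveCartier 𝓗) (hle : ∀ x ∈ C.support, idealOrder 𝓗 x ≤ m) :
    controlledTransform τ C 𝓗 m = strictTransformIdeal τ C 𝓗 := by
  haveI : IsLocallyNoetherian W' := hτ.isLocallyNoetherian
  refine le_antisymm (controlledTransform_le_strictTransformIdeal τ C 𝓗 m) (le_of_forall_stalkIdeal_le fun x' => ?_)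
  by_cases hx : τ x' ∈ C.support
  swap
  · -- off the centre the strict transform is the total transform, which lies in every controlled transform
    rw [hτ.stalkIdeal_strictTransformIdeal_of_not_mem 𝓗 hx]
    exact stalkIdeal_mono (comap_le_controlledTransform τ C 𝓗 m) x'
  -- an open `V ∋ τ x'` of `W` over which the centre is irreducible
  obtain ⟨V, hxV, hirr⟩ := exists_opens_isIrreducible_support_inter C hC hx
  -- the restricted data over `V`
  have hτV : IsBlowup (τ ∣_ V) (C.comap V.ι) := IsBlowup.morphismRestrict τ V hτ
  have hWV : Scheme.IsRegular (V : Scheme.{u}) := hW.of_isOpenImmersion V.ι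
  have hCV : Scheme.IsRegular (C.comap V.ι).subscheme := isRegular_subscheme_comap_of_isOpenImmersion V.ι C hC
  have h𝓗V : IsEffectiveCartier (𝓗.comap V.ι) := h𝓗.comap_of_isOpenImmersion V.ι
  have hsuppV : ((C.comap V.ι).support : Set V) = V.ι ⁻¹' (C.support : Set W) := by
    ext v
    rw [SetLike.mem_coe, support_comap]
    rfl
  have hirrV : IsIrreducible ((C.comap V.ι).support : Set V) := by
    rw [hsuppV]
    refine ⟨⟨⟨τ x', hxV⟩, ?_⟩, ?_⟩
    · show V.ι ⟨τ x', hxV⟩ ∈ (C.support : Set W)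
      simpa using hx
    · have hpre : IsPreirreducible (V.ι ⁻¹' ((C.support : Set W) ∩ (V : Set W))) :=
        hirr.isPreirreducible.preimage V.ι.isOpenEmbedding
      have heq : V.ι ⁻¹' ((C.support : Set W) ∩ (V : Set W)) = V.ι ⁻¹' (C.support : Set W) := by
        ext v
        simp only [Set.mem_preimage, Set.mem_inter_iff, SetLike.mem_coe, and_iff_left_iff_imp]
        intro _
        rw [Scheme.Opens.ι_apply]
        exact v.2
      rwa [heq] at hpre
  obtain ⟨η, hη⟩ := QuasiSober.sober hirrV (C.comap V.ι).support.isClosed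
  have hintV : interior ((C.comap V.ι).support : Set V) = ∅ := by
    rw [hsuppV]
    apply Set.eq_empty_of_forall_notMem
    intro v hv
    have hopen : IsOpen (V.ι '' interior (V.ι ⁻¹' (C.support : Set W))) :=
      V.ι.isOpenEmbedding.isOpenMap _ isOpen_interior
    have hsub : V.ι '' interior (V.ι ⁻¹' (C.support : Set W)) ⊆ (C.support : Set W) := by
      rintro _ ⟨w, hw, rfl⟩
      exact (interior_subset (s := V.ι ⁻¹' (C.support : Set W)) hw : _)
    have : V.ι v ∈ interior (C.support : Set W) := interior_maximal hsub hopen ⟨v, hv, rfl⟩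
    rw [hint] at this
    exact this
  -- the generic order `a ≤ m` along this component
  have hxV' : (⟨τ x', hxV⟩ : V) ∈ ((C.comap V.ι).support : Set V) := by
    rw [hsuppV]
    show V.ι ⟨τ x', hxV⟩ ∈ (C.support : Set W)
    simpa using hx
  haveI : IsRegularLocalRing ((V : Scheme.{u}).presheaf.stalk η) := hWV η
  obtain ⟨e, he0, he⟩ := h𝓗V.exists_stalkIdeal_eq_span η
  have hne : stalkIdeal (𝓗.comap V.ι) η ≠ ⊥ := by
    rw [he, Ne, Ideal.span_singleton_eq_bot]
    exact nonZeroDivisors.ne_zero he0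
  have hlt : idealOrder (𝓗.comap V.ι) η < ⊤ := idealOrder_lt_top_of_stalkIdeal_ne_bot hne
  obtain ⟨a, ha⟩ : ∃ a : ℕ, idealOrder (𝓗.comap V.ι) η = a := ENat.ne_top_iff_exists.mp hlt.ne |>.imp fun a h => h.symm
  have ham : a ≤ m := by
    haveI : IsRegularLocalRing ((V : Scheme.{u}).presheaf.stalk ⟨τ x', hxV⟩) := hWV _
    have h1 : idealOrder (𝓗.comap V.ι) η ≤ idealOrder (𝓗.comap V.ι) ⟨τ x', hxV⟩ :=
      idealOrder_le_of_specializes (hη.specializes hxV') _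
    rw [ha, idealOrder_comap_of_isOpenImmersion V.ι 𝓗] at h1
    have h2 := h1.trans (hle (τ x') hx)
    exact_mod_cast h2
  -- the exact-weight theorem on `V`, transported back to `W'`
  have hEqV := hτV.strictTransformIdeal_eq_controlledTransform hWV hCV hη hintV ha h𝓗V
  rw [strictTransformIdeal_morphismRestrict, controlledTransform_morphismRestrict] at hEqV
  have hx'V : x' ∈ τ ⁻¹ᵁ V := hxV
  have hst : stalkIdeal (strictTransformIdeal τ C 𝓗) x' ≤ stalkIdeal (controlledTransform τ C 𝓗 a) x' :=
    stalkIdeal_le_of_stalkIdeal_comap_le (τ ⁻¹ᵁ V).ι (I := strictTransformIdeal τ C 𝓗)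
      (J := controlledTransform τ C 𝓗 a) ⟨x', hx'V⟩ rfl (by rw [hEqV])
  exact hst.trans (stalkIdeal_mono (controlledTransform_mono_weight τ C 𝓗 ham) x')

/-- **LC-ST, stalk-principal phrasing** (memo (r1) / idea-2's shape): the same with «hypersurface» read as «every stalk `𝓗_x` principal and nonzero»
(on the regular `W` the stalks are domains, so such an `𝓗` is an effective Cartier ideal, ✓ `isEffectiveCartier_of_forall_mem_nonZeroDivisors`).
[cite: Kollar2007, 3.30.2] -/
theorem controlledTransform_eq_strictTransformIdeal_of_forall_isPrincipal [IsLocallyNoetherian W]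
    (hW : Scheme.IsRegular W) (hC : Scheme.IsRegular C.subscheme) (hint : interior (C.support : Set W) = ∅)
    (hτ : IsBlowup τ C) (h𝓗 : ∀ x, (stalkIdeal 𝓗 x).IsPrincipal) (h𝓗0 : ∀ x, stalkIdeal 𝓗 x ≠ ⊥)
    (hle : ∀ x ∈ C.support, idealOrder 𝓗 x ≤ m) :
    controlledTransform τ C 𝓗 m = strictTransformIdeal τ C 𝓗 := by
  refine controlledTransform_eq_strictTransformIdeal_of_idealOrder_le hW hC hint hτ ?_ hle
  refine isEffectiveCartier_of_forall_mem_nonZeroDivisors fun x _ => ?_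
  haveI : IsRegularLocalRing (W.presheaf.stalk x) := hW x
  haveI := isDomain_of_isRegularLocalRing (W.presheaf.stalk x)
  obtain ⟨g, hg⟩ := (Submodule.isPrincipal_iff _).mp (h𝓗 x)
  have hg' : stalkIdeal 𝓗 x = Ideal.span {g} := hg
  refine ⟨g, mem_nonZeroDivisors_of_ne_zero ?_, hg'⟩
  rintro rfl
  apply h𝓗0 x
  rw [hg', Ideal.span_singleton_eq_bot]

/-- **LC-ST in the currency of a Kollár round** (`CentreSeq.IsAdmissibleFor`: `supp C ⊆ cosupp(𝓗, m)` together with `max-ord 𝓗 ≤ m`): along a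
regular nowhere-dense centre of a hypersurface `𝓗` of maximal order `≤ m`, the marked transform `(τ^*𝓗 : 𝓘_E^m)` is the strict transform (Kollár 3.60:
`π^*X = m·E + X′` when `mult_Z X = m`; here only `≤ m` everywhere is used). [cite: Kollar2007, 3.58–3.60] -/
theorem controlledTransform_eq_strictTransformIdeal_of_forall_idealOrder_le [IsLocallyNoetherian W]
    (hW : Scheme.IsRegular W) (hC : Scheme.IsRegular C.subscheme) (hint : interior (C.support : Set W) = ∅)
    (hτ : IsBlowup τ C) (h𝓗 : IsEffectiveCartier 𝓗) (hmax : ∀ x : W, idealOrder 𝓗 x ≤ m) :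
    controlledTransform τ C 𝓗 m = strictTransformIdeal τ C 𝓗 :=
  controlledTransform_eq_strictTransformIdeal_of_idealOrder_le hW hC hint hτ h𝓗 fun x _ => hmax x

end LargeChar

end Summit.ResolutionOfSingularities.ResolutionOfSingularities.Cruxes.EquisingularLiftNat.Sections

end
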